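import Summits.BirchSwinnertonDyer.BirchSwinnertonDyer.Theorems.EisensteinPrimesMazurMCOnCellBTwistbackLamOneRankOne
import Summits.BirchSwinnertonDyer.BirchSwinnertonDyer.Theorems.EisensteinPrimesMazurMCOnCellBTwistbackKLFlatPartner
import HarnessLib

/-!
# Crux 3 `MazurMCOnCellB` (stmt-BirchSwinnertonDyer-19033), line `twistback` v4 — the LOCAL BALANCE of an admissible
# partner of a non-split X2b pair is NEVER `0` (kernel form of the Kriz–Li supply audit: «c(E) ≥ 1»)

Width seat bsd-line-x2-p1-w5 (g0), 2026-08-28; sequel of `…TwistbackLamOneRankOne` (p649897). HONEST FRAMING (cell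
`bsd-eis`, run/shared/lean/pub/bsd-eis/): conditional theorems only; named facts BY NAME: Wuthrich 2014 Thm. 16, the
parametrisation supply and modularity (conjuncts of the route's `PublishedInputs`), Greenberg–Vatsal Thm. (3.11)+(28)
(`thm311_…`, PUB), Dokchitser–Dokchitser 2010 Thm. 1.4 (`selmerCorank_mod_two_eq`, PUB). ALL PUBLISHED — no preprint
enters this file. No `def`, no `sorry`; nothing about any curve is proved unconditionally; 0 cells / labels / stubs /
tiers move.

WHY (audit `Cruxes/MazurMCOnCellB/Lines/twistback-krizli-supply-audit-w5.md` §1(c), there a desk/census statement —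
44/44 non-split A10 cells have `c(E) ≥ 1` — here a THEOREM of the road's own currency): Kriz–Li 2019 Thm. 1.20's
hypotheses («no split multiplicative prime», the additive conditions) say that the local balance of p645419 §1 is `0`.
But at a NON-split multiplicative Eisenstein prime `p ≠ 2` a curve of ODD analytic rank cannot carry the certificate
`(μ_an, λ_an) = (0, 0)`: `λ_an = 0` bounds `corank_{ℤ_p} Sel_{p^∞}(E/ℚ)` by `0` (the squeeze of p649897 §1: Wuthrich
Thm. 16 + Greenberg's Lemma 3.1 + the structure theorem), while `p`-parity makes the corank odd. Every admissible
partner `E^{(d_K)}` of an X2b pair has odd analytic rank (p649897 §2), so NO KL-flat ramified-even carrier of it has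
balance `0` — the sub-row «Kriz–Li's setting» of LEAD g10's verdict §2 is EMPTY as a theorem (modulo GV Thm. (3.11),
Wuthrich, Dokchitser), not only on the census.

* §1 `not_analyticLambdaEq_zero_of_odd` — `p ≠ 2` non-split multiplicative, `E[p]` reducible, `r_an` odd,
  `AnalyticMuLE W p 0` ⟹ `¬ AnalyticLambdaEq W p 0`.
* §2 `one_le_of_analyticLambdaEq_of_odd` — same data, `AnalyticLambdaEq W p n` ⟹ `1 ≤ n`.
* §3 `balance_ne_zero_of_klFlat_carrier_of_twist` — X2b non-split `(W, p)`, `K` admissible, `Wd` a minimal model of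
  `E^{(d_K)}`, `V′` isogenous to `Wd` with a KL-flat ramified-even line datum of balance `n` ⟹ `n ≠ 0` (so `n ≥ 1`).

References: [Wuthrich2014] Thm. 16; [GreenbergLNM1716] §3 Lemma 3.1; [Washington1997] §7.1, Thm. 13.12;
[DokchitserDokchitserAnnals2010] Thm. 1.4; [GreenbergVatsal2000] §3 Thm. (3.11); [KrizLi2019] Thm. 1.20 (hypotheses (2)–(3),
for contrast; not used).
-/

set_option autoImplicit false

-- `Summit.BirchSwinnertonDyer.BirchSwinnertonDyer.…`: the summit and its single sub-problem share a name.
set_option linter.dupNamespace false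

noncomputable section

open scoped Classical MatrixGroups ModularForm

open CongruenceSubgroup WeierstrassCurve NumberField IsDedekindDomain Field PowerSeries
  Literature.NumberTheory.EllipticCurves
  Literature.NumberTheory.GaloisRepresentations
  Literature.NumberTheory.EllipticCurves.ModularForms
  Literature.NumberTheory.QuadraticFields
  Literature.NumberTheory.EllipticCurves.Rank1Residual
  Literature.NumberTheory.EllipticCurves.Rank1Residual.Typed
  Literature.NumberTheory.EllipticCurves.Wuthrich2014
  Literature.NumberTheory.EllipticCurves.GreenbergVatsal2000
  Literature.NumberTheory.EllipticCurves.IwasawaAlgebra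
  Summit.BirchSwinnertonDyer.Rank1Residual
  Summit.BirchSwinnertonDyer.Rank1Residual.X2
  Summit.BirchSwinnertonDyer.Rank1Residual.X2.IsogenyQuotientLine
  Summit.BirchSwinnertonDyer.Rank1Residual.X1.MuLambda
  Summit.BirchSwinnertonDyer.Rank1Residual.X1.RankOneParitySqueeze
  Summit.BirchSwinnertonDyer.BirchSwinnertonDyer.Theses
  Summit.BirchSwinnertonDyer.BirchSwinnertonDyer.Theorems.EisensteinPrimesLambdaFromCharacters
  Summit.BirchSwinnertonDyer.BirchSwinnertonDyer.Theorems.EisensteinPrimesMazurMCOnCellBTwistbackLamOneRankOne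

namespace Summit.BirchSwinnertonDyer.BirchSwinnertonDyer.Theorems.EisensteinPrimesMazurMCOnCellBTwistbackBalancePositive

/-! ## §1. A curve of odd analytic rank cannot have `(μ_an, λ_an) = (0, 0)` at a non-split multiplicative Eisenstein prime -/

/-- **`λ_an = 0` is impossible at odd analytic rank** (non-split multiplicative Eisenstein `p ≠ 2`): the squeeze
`corank Sel_{p^∞}(E/ℚ) ≤ rank_{ℤ_p} X/TX ≤ ord_{T=0} g ≤ λ(g)` (Wuthrich Thm. 16 at the tree datum: `g ∈ char_Λ X`,
`ι g = ϖ·L`; tree theorems `selmerCorank_le_coinvariantsRank`, `coinvariantsRank_le_order_of_mem_charIdeal`,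
`order_le_lam`) would give corank `0`, contradicting `p`-parity (`hDD`: corank ≡ r_an ≡ 1 (mod 2)). PUB inputs only.
[cite: Wuthrich2014, Thm. 16 (p. 397)] [cite: GreenbergLNM1716, §3 Lemma 3.1] [cite: DokchitserDokchitserAnnals2010, Thm. 1.4] -/
theorem not_analyticLambdaEq_zero_of_odd (hWu : thm16_charIdeal_dvd_multiplicative_of_reducible)
    (hpar : nonempty_modularParametrizationData)
    (W : WeierstrassCurve ℚ) [W.IsElliptic] [W.IsGloballyMinimal] (p : ℕ) [Fact p.Prime]
    (hDD : selmerCorank_mod_two_eq W p)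
    (hp2 : p ≠ 2) (hmult : W.HasMultiplicativeReductionAtPrime p)
    (hns : ¬ W.HasSplitMultiplicativeReductionAtPrime p) (hred : ¬ W.HasIrreducibleModPGaloisRep p)
    (hodd : Odd W.analyticRank) (hμ0 : AnalyticMuLE W p 0) :
    ¬ AnalyticLambdaEq W p 0 := by
  intro hlam
  -- the cyclotomic datum, the Selmer dual, a newform with its `ϖ`, THE non-split `p`-adic `L`-function
  obtain ⟨κ, hκ, γ, hγ, hγ'⟩ := exists_isCyclotomic_isTopGenerator_isCyclotomicVariable_holds p
  obtain ⟨D⟩ := W.nonempty_selmerDualData_holds κ γ hγ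
  haveI : NeZero (W.conductorNorm ℤ) := ⟨(W.conductorNorm_pos_holds).ne'⟩
  obtain ⟨Dm⟩ := hpar W
  obtain ⟨ϖ, -, hϖ, -⟩ := Dm.exists_rat_mul_realPeriodRat_eq_plusPeriod
  obtain ⟨L, hL⟩ := exists_isMultPAdicLFunctionOf_neg_one_of_nonsplit Dm.isNewformOf hmult hns
  haveI : Module.Finite (IwasawaAlgebra p) D.X := D.module_finite_holds hγ
  obtain ⟨hX, hKns, -⟩ := hWu W p hp2 hmult hred hκ hγ hγ' Dm.isNewformOf D ϖ hϖ
  obtain ⟨g, hg, hιg⟩ := hKns hns L hL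
  have hlamg : lam g = 0 :=
    hlam Dm.f Dm.isNewformOf ϖ hϖ L (fun hs ↦ absurd hs hns) (fun _ ↦ hL) g hιg
  obtain ⟨k, hk⟩ := hμ0 Dm.f Dm.isNewformOf ϖ hϖ L (fun hs ↦ absurd hs hns) (fun _ ↦ hL)
  have hL0 : PowerSeries.C ((ϖ : ℚ) : ℚ_[p]) * L ≠ 0 := ne_zero_of_lt_norm_coeff hk
  have hg0 : g ≠ 0 := by
    rintro rfl
    exact hL0 (by rw [← hιg, map_zero])
  -- the squeeze: `corank Sel ≤ rank X/TX ≤ ord_T g ≤ λ(g) = 0`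
  have h1 : W.selmerCorank p ≤ coinvariantsRank p D.X := W.selmerCorank_le_coinvariantsRank hγ D
  have h2 : (coinvariantsRank p D.X : ℕ∞) ≤ g.order :=
    coinvariantsRank_le_order_of_mem_charIdeal D.X hX g hg
  have h3 : g.order ≤ ((lam g : ℕ) : ℕ∞) := order_le_lam hg0
  have h4 : (coinvariantsRank p D.X : ℕ∞) ≤ ((0 : ℕ) : ℕ∞) := by
    rw [← hlamg]; exact h2.trans h3
  have h5 : coinvariantsRank p D.X ≤ 0 := by exact_mod_cast h4
  have h0 : W.selmerCorank p = 0 := Nat.le_zero.mp (h1.trans h5)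
  -- parity
  have hmod : W.selmerCorank p % 2 = W.analyticRank % 2 := hDD
  rcases hodd with ⟨m, hm⟩
  omega

/-! ## §2. Hence `λ_an ≥ 1` -/

/-- **`λ_an ≥ 1` at odd analytic rank** (non-split multiplicative Eisenstein `p ≠ 2`): if `AnalyticLambdaEq W p n` holds
(for THE non-split function, any newform/`ϖ`), then `1 ≤ n`. [cite: Wuthrich2014, Thm. 16 (p. 397)]
[cite: DokchitserDokchitserAnnals2010, Thm. 1.4] -/
theorem one_le_of_analyticLambdaEq_of_odd (hWu : thm16_charIdeal_dvd_multiplicative_of_reducible)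
    (hpar : nonempty_modularParametrizationData)
    (W : WeierstrassCurve ℚ) [W.IsElliptic] [W.IsGloballyMinimal] (p : ℕ) [Fact p.Prime]
    (hDD : selmerCorank_mod_two_eq W p)
    (hp2 : p ≠ 2) (hmult : W.HasMultiplicativeReductionAtPrime p)
    (hns : ¬ W.HasSplitMultiplicativeReductionAtPrime p) (hred : ¬ W.HasIrreducibleModPGaloisRep p)
    (hodd : Odd W.analyticRank) (hμ0 : AnalyticMuLE W p 0) {n : ℕ} (hlam : AnalyticLambdaEq W p n) :
    1 ≤ n := by
  by_contra h0
  obtain rfl : n = 0 := by omega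
  exact not_analyticLambdaEq_zero_of_odd hWu hpar W p hDD hp2 hmult hns hred hodd hμ0 hlam

/-! ## §3. The balance of a KL-flat carrier of an admissible partner of a non-split X2b pair is never `0` -/

/-- **«Kriz–Li's setting» is EMPTY on the non-split X2b row, as a theorem of the road's currency.** For a NON-split
X2b pair `(W, p)` (`r_an(W) = 0`), an admissible `K` (imaginary quadratic, Heegner for `N_W` and for `p`), a globally
minimal model `Wd` of `E^{(d_K)}`, and `V′` `ℚ`-isogenous to `Wd` carrying a rational line `Φ₀` ramified at `p` and
even with primitive characters `φ` (`p ∣ m`), `ψ` (`p ∤ d`), `S₀ ∌ p` ⊇ bad places, KL-flat (`‖L_∅(C,0)‖ = ‖L_∅(D,0)‖ = 1`)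
and local balance `n` (`n + Σ_v δ = Σ_v s_v([φ(v)=v̄]+[ψ(v)=v̄])`): then `n ≠ 0`. Indeed F1 (p645419
`analyticMuLE_zero_and_analyticLambdaEq_of_lineRamifiedEven_of_klFlat`, GV Thm. (3.11) `h311` + Wuthrich `hWu`) gives
`(μ_an, λ_an)(V′) = (0, n)`, `V′` is non-split multiplicative at `p` with `E[p]` reducible and `r_an(V′) = r_an(E^{(d_K)})`
odd (p649897 §2), so §1 forbids `n = 0`. In Kriz–Li's language: at least one Euler factor of their congruence (29)
vanishes at every partner — Thm. 1.20's hypotheses (2)–(3) never hold there. PUB inputs only (`PublishedInputs`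
conjuncts, GV Thm. (3.11), Dokchitser). [cite: GreenbergVatsal2000, §3 Thm. (3.11) (p. 43)] [cite: Wuthrich2014, Thm. 16 (p. 397)]
[cite: DokchitserDokchitserAnnals2010, Thm. 1.4] [cite: KrizLi2019, Thm. 1.20 (hypotheses (2)–(3); contrast only)] -/
theorem balance_ne_zero_of_klFlat_carrier_of_twist (hP : EisensteinPrimes.PublishedInputs)
    (h311 : thm311_hasUnitContent_iff_and_order_eq_of_lineRamifiedEven)
    (hDD : ∀ (V : WeierstrassCurve ℚ) [V.IsElliptic] (ℓ : ℕ) [Fact ℓ.Prime], selmerCorank_mod_two_eq V ℓ)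
    (W : WeierstrassCurve ℚ) [W.IsElliptic] [W.IsGloballyMinimal] (p : ℕ) [Fact p.Prime]
    (hc : X2.CellB W p) (hns : ¬ W.HasSplitMultiplicativeReductionAtPrime p)
    (K : Type) [Field K] [NumberField K] (hK : IsImaginaryQuadratic K)
    (hHN : SatisfiesHeegnerHypothesis (W.conductorNorm ℤ) K) (hHp : SatisfiesHeegnerHypothesis p K)
    (Wd : WeierstrassCurve ℚ) [Wd.IsElliptic] [Wd.IsGloballyMinimal]
    (hWd : ∃ C : VariableChange ℚ, C • Wd = W.quadraticTwist (NumberField.discr K : ℚ))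
    (V' : WeierstrassCurve ℚ) [V'.IsElliptic] [V'.IsGloballyMinimal] (hiso : IsIsogenous Wd V')
    (S₀ : Finset (HeightOneSpectrum (𝓞 ℚ))) (Φ₀ : AddSubgroup (V'.geomTorsion (p : ℤ)))
    (m : ℕ) [NeZero m] (φ : DirichletCharacter (ZMod p) m)
    (d : ℕ) [NeZero d] (ψ : DirichletCharacter (ZMod p) d)
    (hΦ : IsRationalLine V' p Φ₀) (hram : ¬ LineUnramifiedAt V' p Φ₀) (heven : LineEven V' p Φ₀)
    (hφ : φ.IsPrimitive) (hψ : ψ.IsPrimitive) (hpm : p ∣ m) (hpd : ¬ p ∣ d)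
    (hφ0 : ∀ (σ : absoluteGaloisGroup ℚ), ∀ Q ∈ Φ₀,
      σ • Q = (φ ((modNCyclotomicCharacter ℚ m σ : (ZMod m)ˣ) : ZMod m)).val • Q)
    (hψ0 : ∀ (σ : absoluteGaloisGroup ℚ) (Q : V'.geomTorsion (p : ℤ)),
      σ • Q - (ψ ((modNCyclotomicCharacter ℚ d σ : (ZMod d)ˣ) : ZMod d)).val • Q ∈ Φ₀)
    (hS₀p : ∀ v ∈ S₀, ((p : ℕ) : 𝓞 ℚ) ∉ v.asIdeal)
    (hS : ∀ v : HeightOneSpectrum (𝓞 ℚ), v ∉ S₀ → ((p : ℕ) : 𝓞 ℚ) ∉ v.asIdeal → V'.HasGoodReductionAt v)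
    (hC1 : ‖characterLValueC p φ ∅ 1‖ = 1) (hD1 : ‖characterLValueD p ψ ∅ 1‖ = 1)
    (n : ℕ)
    (hbal : n + ∑ v ∈ S₀, delta V' p v =
      ∑ v ∈ S₀, ((if φ (Rat.HeightOneSpectrum.natGenerator v : ZMod m) =
            (Rat.HeightOneSpectrum.natGenerator v : ZMod p)
          then sFactor p (Rat.HeightOneSpectrum.natGenerator v) else 0) +
        (if ψ (Rat.HeightOneSpectrum.natGenerator v : ZMod d) =
            (Rat.HeightOneSpectrum.natGenerator v : ZMod p)
          then sFactor p (Rat.HeightOneSpectrum.natGenerator v) else 0))) :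
    n ≠ 0 := by
  have hpar := hP.2.2.2.2.1
  have hnf := hP.2.2.2.2.2.1
  have hWu := hP.2.2.2.2.2.2.2.2.2.2.2.2.2.2.1
  have hp2 : p ≠ 2 := hc.2.1.1
  have hmult : W.HasMultiplicativeReductionAtPrime p := hc.2.1.2.2
  have hr0 : W.analyticRank = 0 := hc.1
  obtain ⟨C, hC⟩ := hWd
  -- the carrier is NON-split multiplicative at `p` with `E[p]` reducible
  have hXd : ClassX2 Wd p := X2.classX2_twist W p hc.2.1 K hK hHp Wd ⟨C, hC⟩
  have hnsd : ¬ Wd.HasSplitMultiplicativeReductionAtPrime p := fun hs ↦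
    hns ((X2.hasSplitMultiplicativeReductionAtPrime_iff_of_smul_eq_quadraticTwist W Wd hK p hp2 hmult hHp
      hC).mp hs)
  have hmult' : V'.HasMultiplicativeReductionAtPrime p :=
    hasMultiplicativeReductionAtPrime_of_isIsogenous hiso hXd.2.2
  have hns' : ¬ V'.HasSplitMultiplicativeReductionAtPrime p := fun hs ↦
    hnsd ((hasSplitMultiplicativeReductionAtPrime_iff_of_isIsogenous (p := p) hiso).mpr hs)
  have hred' : ¬ V'.HasIrreducibleModPGaloisRep p := not_hasIrreducibleModPGaloisRep_of_isRationalLine hΦ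
  -- F1: `(μ_an, λ_an)(V', p) = (0, n)`
  obtain ⟨hμ, hlam⟩ := analyticMuLE_zero_and_analyticLambdaEq_of_lineRamifiedEven_of_klFlat V' p h311 hWu S₀ Φ₀
    m φ d ψ hp2 hmult' hΦ hram heven hφ hψ hpm hpd hφ0 hψ0 hS₀p hS hC1 hD1 n hbal
  -- `r_an(V') = r_an(Wd) = r_an(E^{(d_K)})` is odd
  have hrd : Wd.analyticRank = (W.quadraticTwist (NumberField.discr K : ℚ)).analyticRank := by
    have h := congrArg WeierstrassCurve.analyticRank hC
    rwa [analyticRank_smul] at h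
  have hoddV : Odd V'.analyticRank := by
    rw [← analyticRank_eq_of_isIsogenous' hiso, hrd]
    exact EisensteinPrimesMazurMCOnCellBTwistbackLamOneRankOne.odd_analyticRank_quadraticTwist_of_analyticRank_eq_zero
      hnf W hr0 K hK hHN
  -- §1
  have h1 := one_le_of_analyticLambdaEq_of_odd hWu hpar V' p (hDD V' p) hp2 hmult' hns' hred' hoddV hμ hlam
  omega

end Summit.BirchSwinnertonDyer.BirchSwinnertonDyer.Theorems.EisensteinPrimesMazurMCOnCellBTwistbackBalancePositive

end
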